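import Summits.CriticalPhenomena.CardyFormulaZ2.Theses.CardyMeckeFlip

/-!
# Glue: the three law-level cruxes of route `CardyMeckeFlip` give `SublimitsCardy`

Route `CardyMeckeFlip`, support item `CruxesToSublimitsCardy` (stmt-CriticalPhenomena-14160):
`MeckeRigidity → FlipErgodicityZ2 → Z2LimitsSymmetric → SublimitsCardy`.

Pure logic.  For a subsequential quad-crossing limit `μ ∈ subseqQuadLimits univ`,
`Z2LimitsSymmetric` supplies (probability, isometry invariance, self-duality, the RSW constant
`c > 0` and the 3:1 bound); `FlipErgodicityZ2`, instantiated at the pivotal predicate `Piv :=`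
its own defining formula (the characterising hypothesis is discharged by `Iff.rfl`), supplies an
admissible flip-fair kernel family `M` together with midpoint-extremality of `μ`; and
`MeckeRigidity` at the same `Piv`, applied to `(μ, M)` with these data, returns the Cardy
crossing values — which is `SublimitsCardy` at `μ`.  This is literally the first `have` of the
route's deciding theorem `closes`.
-/

namespace Summit.CriticalPhenomena.CardyFormulaZ2.Theorems.CardyMeckeFlip

open Summit.CriticalPhenomena.CardyFormulaZ2.Theses.CardyMeckeFlip

/-- **Target reachability for route `CardyMeckeFlip`** (item `CruxesToSublimitsCardy`,
stmt-CriticalPhenomena-14160): the law-level cruxes `MeckeRigidity`, `FlipErgodicityZ2` and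
`Z2LimitsSymmetric` together imply `SublimitsCardy` — every subsequential quad-crossing scaling
limit of bond-`ℤ²` percolation at `p = ½` has Cardy crossing values.  Proof: instantiate both
parametrised cruxes at the pivotal predicate given by its defining formula (`Iff.rfl`) and chain
them through the symmetry data of `Z2LimitsSymmetric`. -/
theorem cruxesToSublimitsCardy_proof : CruxesToSublimitsCardy := by
  unfold CruxesToSublimitsCardy
  intro hK2 hK3 hS μ hμ
  obtain ⟨hprob, hsym, hdual, c, hc, hrsw⟩ := hS μ hμ
  -- `Piv := its defining predicate` is found by unification from `Iff.rfl`
  obtain ⟨M, hadm, hff, hext⟩ := hK3 _ (fun _ _ _ => Iff.rfl) μ hμ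
  exact hK2 _ (fun _ _ _ => Iff.rfl) _ M hprob hsym hdual c hc hrsw hadm hff hext

end Summit.CriticalPhenomena.CardyFormulaZ2.Theorems.CardyMeckeFlip
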